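import Literature.NumberTheory.Automorphic.UnitaryGroupArthurTraceThreeSocketsClosedKit
import Literature.NumberTheory.Automorphic.UnitaryGroupArthurTraceThreeSocketsExplicitCM
import HarnessLib

/-!
# `J(f)` for the quasi-split `U(J₃)` of a CM field — EXPLICIT (three sockets closed) IN KIT CURRENCY
(Rogawski, *Automorphic Representations of Unitary Groups in Three Variables* (1990), §2.3 p. 14 «`J(f) = Σ_𝔬 J_𝔬(f)`», §3.4–3.6
(pp. 23–27: orbital integrals over the rational classes), (6.1.3), Prop. 7.2.2 ∕ (7.2.3), Prop. 7.3.2; Arthur, *A trace formula for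
reductive groups I*, Duke Math. J. 45 (1978), §8.)

Topic `NumberTheory/Automorphic`; namespace `Literature.NumberTheory.Automorphic.UnitaryGroup`. THEOREMS ONLY over accepted tree
modules (no definition, no named fact, no instance, no notation, no `sorry`). Row (L5-KIT) sequel, third leaf, of the T1-qs LAW 5
road of `Cruxes/H413/Lines/F0_T1InnerFormTraceIdentity.lean` (cell `pub/hodgecm-mathlib`, crux H413): the KIT twin of ★
`arthurTrace_eq_orbital_add_central_add_singular_add_hyperbolic_explicit_cm` (`UnitaryGroupArthurTraceThreeSocketsExplicitCM`, row
(L5-ω), F0P3a-p07) — the SAME explicit central ∕ singular ∕ hyperbolic sums, the elliptic term in the currency the ENGINE line's `SJ_G`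
letters read: orbital sums over `ConjClasses (quasiSplit L⁺ L c 3).Rational` along the diagonal `toAdelic` with the kit's
class-indexed orbital integrals ★ `classOrbitalIntegralAlong toAdelic m f c`, for ANY total family `m` agreeing with the Weil
quotients `ν ∕ νR c` on the elliptic classes (antecedent after the preamble) — i.e. ★
`arthurTrace_eq_sum_classOrbitalIntegralAlong_add_central_add_singular_add_hyperbolic_of_closers_cm`
(`UnitaryGroupArthurTraceThreeSocketsClosedKit` §1) with its two closer hypotheses instantiated EXACTLY as row (L5-ω) instantiates the
skeleton's: `closerC :=` ★ `exists_keyrep_sum_filter_central_classPolynomial_eval_zero_cm`, `closerS :=` ★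
`exists_keyrep_sum_filter_singular_classPolynomial_eval_zero_cm`. Binders = ★ `…_explicit_cm`'s with `rep hrep νC` replaced by the
kit's `νR m`; statement generated mechanically from the tree texts (binder prefix and instance preamble compared = identical strings;
elliptic summand = `…ClosedKit` §1's verbatim; closed sums = `…_explicit_cm`'s verbatim); proof = row (L5-ω)'s, over the kit skeleton.

* **`arthurTrace_eq_sum_classOrbitalIntegralAlong_add_central_add_singular_add_hyperbolic_explicit_cm`**.

HC_CM is proved only modulo the 7 printed citations until rung 0 closes — nothing here bears on a summit statement.

## References
* [Rogawski1990] J. D. Rogawski, *Automorphic Representations of Unitary Groups in Three Variables*, Ann. of Math. Stud. 123 (1990),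
  §2.3 (p. 14), §3.4–§3.6 (pp. 23–27), §6.1 (pp. 79–81), §7.2–§7.3 (pp. 91–97).
* [Arthur1978TraceFormulaI] J. Arthur, *A trace formula for reductive groups I*, Duke Math. J. 45 (1978), §8.
-/

set_option autoImplicit false

noncomputable section

open MeasureTheory Measure NumberField IsDedekindDomain Set Matrix Polynomial
open Literature.MeasureTheory.Group
open Literature.NumberTheory.Automorphic.Meyer
open Literature.NumberTheory.QuadraticForms (normIdeles)
open scoped NNReal ENNReal Classical MatrixGroups

namespace Literature.NumberTheory.Automorphic

namespace UnitaryGroup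

/-- **`J(f)` EXPLICIT, IN KIT CURRENCY.** For the quasi-split `U(J₃)` of the CM field `L`, centraliser Haar measures `νR c` and a
total family `m` of orbit measures on `ConjClasses (quasiSplit L⁺ L c 3).Rational` which is the Weil quotient `ν ∕ νR c` on the ELLIPTIC
classes, and the letters of rows (σ-i) ∕ (σ-ii) ∕ (σ-iii): there are keys `zrep srep hyrep` with `J(f) =` (kit elliptic term:
`Σ_{i elliptic} c_μ·Σ'_{c : cl♭(γ_c·1) = i} covol(G_{γ_c}(L⁺)·1 ∖ G_{γ_c}(𝔸); νR c)·classOrbitalIntegralAlong toAdelic m f c`) `+` (the explicit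
central sum of [Prop. 7.3.2]) `+` (the explicit singular sum of [Prop. 7.2.2]) `+` (`Σ_{hyperbolic} −(c_μ·C_w·J^v(hyrep i, f))` of
[(6.1.3)]) — the three closed sums being ★ `…_explicit_cm`'s VERBATIM. Proof: ★ `…_of_closers_cm` at the two ★ keyed closers.
[cite: Rogawski1990, §2.3 (p. 14); §3.4–3.6; (6.1.3); Prop. 7.2.2; Prop. 7.3.2] [cite: Arthur1978TraceFormulaI, §8] -/
theorem arthurTrace_eq_sum_classOrbitalIntegralAlong_add_central_add_singular_add_hyperbolic_explicit_cm (L : Type) [Field L] [NumberField L] [IsCMField L]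
    [instMA : MeasurableSpace (quasiSplit (↥(maximalRealSubfield L)) L (IsCMField.complexConj L) 3).Adelic] [instBA : BorelSpace (quasiSplit (↥(maximalRealSubfield L)) L (IsCMField.complexConj L) 3).Adelic]
    (ν : Measure (quasiSplit (↥(maximalRealSubfield L)) L (IsCMField.complexConj L) 3).Adelic) [instν : IsHaarMeasure ν]
    (μ : Measure (quasiSplit (↥(maximalRealSubfield L)) L (IsCMField.complexConj L) 3).automorphicQuotient)
    [instμ : (quasiSplit (↥(maximalRealSubfield L)) L (IsCMField.complexConj L) 3).IsAutomorphicMeasure μ]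
    [instMU : MeasurableSpace (adelicUnipotent (↥(maximalRealSubfield L)) L (IsCMField.complexConj L) 3)]
    [instBU : BorelSpace (adelicUnipotent (↥(maximalRealSubfield L)) L (IsCMField.complexConj L) 3)]
    [instMQ : ∀ γ : (quasiSplit (↥(maximalRealSubfield L)) L (IsCMField.complexConj L) 3).Adelic,
      MeasurableSpace ((quasiSplit (↥(maximalRealSubfield L)) L (IsCMField.complexConj L) 3).Adelic ⧸
        Subgroup.centralizer ({γ} : Set (quasiSplit (↥(maximalRealSubfield L)) L (IsCMField.complexConj L) 3).Adelic))]
    [instBQ : ∀ γ : (quasiSplit (↥(maximalRealSubfield L)) L (IsCMField.complexConj L) 3).Adelic,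
      BorelSpace ((quasiSplit (↥(maximalRealSubfield L)) L (IsCMField.complexConj L) 3).Adelic ⧸
        Subgroup.centralizer ({γ} : Set (quasiSplit (↥(maximalRealSubfield L)) L (IsCMField.complexConj L) 3).Adelic))]
    [instMS : ∀ γ : (quasiSplit (↥(maximalRealSubfield L)) L (IsCMField.complexConj L) 3).Adelic,
      MeasurableSpace (↥(Subgroup.centralizer ({γ} : Set (quasiSplit (↥(maximalRealSubfield L)) L (IsCMField.complexConj L) 3).Adelic)) ⧸
        ((quasiSplit (↥(maximalRealSubfield L)) L (IsCMField.complexConj L) 3).quotientSubgroup ⊓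
          Subgroup.centralizer ({γ} : Set (quasiSplit (↥(maximalRealSubfield L)) L (IsCMField.complexConj L) 3).Adelic)).subgroupOf
          (Subgroup.centralizer ({γ} : Set (quasiSplit (↥(maximalRealSubfield L)) L (IsCMField.complexConj L) 3).Adelic)))]
    [instBS : ∀ γ : (quasiSplit (↥(maximalRealSubfield L)) L (IsCMField.complexConj L) 3).Adelic,
      BorelSpace (↥(Subgroup.centralizer ({γ} : Set (quasiSplit (↥(maximalRealSubfield L)) L (IsCMField.complexConj L) 3).Adelic)) ⧸
        ((quasiSplit (↥(maximalRealSubfield L)) L (IsCMField.complexConj L) 3).quotientSubgroup ⊓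
          Subgroup.centralizer ({γ} : Set (quasiSplit (↥(maximalRealSubfield L)) L (IsCMField.complexConj L) 3).Adelic)).subgroupOf
          (Subgroup.centralizer ({γ} : Set (quasiSplit (↥(maximalRealSubfield L)) L (IsCMField.complexConj L) 3).Adelic)))]
    (ν₀ : Measure (adelicUnipotent (↥(maximalRealSubfield L)) L (IsCMField.complexConj L) 3)) [instν₀ : ν₀.IsHaarMeasure]
    (𝓕 : Set (adelicUnipotent (↥(maximalRealSubfield L)) L (IsCMField.complexConj L) 3))
    (h𝓕 : IsFundamentalDomain (rationalUnipotent (↥(maximalRealSubfield L)) L (IsCMField.complexConj L) 3) 𝓕 ν₀)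
    (νR : ∀ c : ConjClasses (quasiSplit (↥(maximalRealSubfield L)) L (IsCMField.complexConj L) 3).Rational,
      Measure ↥(Subgroup.centralizer ({(quasiSplit (↥(maximalRealSubfield L)) L (IsCMField.complexConj L) 3).toAdelic (Quotient.out c)} : Set (quasiSplit (↥(maximalRealSubfield L)) L (IsCMField.complexConj L) 3).Adelic)))
    [instνR : ∀ c, IsHaarMeasure (νR c)]
    (m : ∀ c : ConjClasses (quasiSplit (↥(maximalRealSubfield L)) L (IsCMField.complexConj L) 3).Rational,
      Measure ((quasiSplit (↥(maximalRealSubfield L)) L (IsCMField.complexConj L) 3).Adelic ⧸ Subgroup.centralizer ({(quasiSplit (↥(maximalRealSubfield L)) L (IsCMField.complexConj L) 3).toAdelic (Quotient.out c)} : Set (quasiSplit (↥(maximalRealSubfield L)) L (IsCMField.complexConj L) 3).Adelic)))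
    (f : (quasiSplit (↥(maximalRealSubfield L)) L (IsCMField.complexConj L) 3).Adelic → ℂ)
    (hf : IsQuasiSplitTest (↥(maximalRealSubfield L)) L (IsCMField.complexConj L) 3 f)
    [MeasurableSpace ((quasiSplit (↥(maximalRealSubfield L)) L (IsCMField.complexConj L) 3).Adelic ⧸
      torusAdelic (↥(maximalRealSubfield L)) L (IsCMField.complexConj L) 3)]
    [BorelSpace ((quasiSplit (↥(maximalRealSubfield L)) L (IsCMField.complexConj L) 3).Adelic ⧸
      torusAdelic (↥(maximalRealSubfield L)) L (IsCMField.complexConj L) 3)]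
    (ρ : Measure ↥(torusAdelic (↥(maximalRealSubfield L)) L (IsCMField.complexConj L) 3)) [ρ.IsHaarMeasure] [ρ.IsInvInvariant]
    {w : (quasiSplit (↥(maximalRealSubfield L)) L (IsCMField.complexConj L) 3).Rational}
    (hw : ((w.1 : GL (Fin 3) L) : Matrix (Fin 3) (Fin 3) L) = !![(0 : L), 0, 1; 0, 1, 0; 1, 0, 0])
    {Cw : ℝ≥0∞} (hC : Cw ≠ ⊤)
    (hwin : ∀ β' : torusInBorel (↥(maximalRealSubfield L)) L (IsCMField.complexConj L) 3 → ℝ≥0∞,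
        IsCoveringWeight ((rationalBorel (↥(maximalRealSubfield L)) L (IsCMField.complexConj L) 3).subgroupOf
          (torusInBorel (↥(maximalRealSubfield L)) L (IsCMField.complexConj L) 3)) β' →
        ∀ A B : ℝ≥0, 0 < A → A ≤ B →
          ∫⁻ s : torusInBorel (↥(maximalRealSubfield L)) L (IsCMField.complexConj L) 3, β' s *
            {s : torusInBorel (↥(maximalRealSubfield L)) L (IsCMField.complexConj L) 3 |
              A < borelHeight (((s : torusInBorel (↥(maximalRealSubfield L)) L (IsCMField.complexConj L) 3) :
                borelAdelic (↥(maximalRealSubfield L)) L (IsCMField.complexConj L) 3) :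
                (quasiSplit (↥(maximalRealSubfield L)) L (IsCMField.complexConj L) 3).Adelic) ∧
              borelHeight (((s : torusInBorel (↥(maximalRealSubfield L)) L (IsCMField.complexConj L) 3) :
                borelAdelic (↥(maximalRealSubfield L)) L (IsCMField.complexConj L) 3) :
                (quasiSplit (↥(maximalRealSubfield L)) L (IsCMField.complexConj L) 3).Adelic) ≤ B}.indicator 1 s
            ∂(Measure.map (⇑(Subgroup.subgroupOfEquivOfLe
              (torusAdelic_le_borelAdelic (F := ↥(maximalRealSubfield L)) (E := L) (c := IsCMField.complexConj L) (N := 3))).symm) ρ :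
                Measure (torusInBorel (↥(maximalRealSubfield L)) L (IsCMField.complexConj L) 3)) =
            Cw * ENNReal.ofReal (Real.log (B : ℝ) - Real.log (A : ℝ)))
    -- the letters of the central closer (★ `truncatedTraceClass_central_eq_linear_cm`) and of the singular closer
    [MeasurableSpace (AdeleRing (𝓞 L) L)] [BorelSpace (AdeleRing (𝓞 L) L)]
    [MeasurableSpace (GaloisRepresentations.ideleGroup L)] [BorelSpace (GaloisRepresentations.ideleGroup L)]
    [MeasurableSpace (AdeleRing (𝓞 (↥(maximalRealSubfield L))) (↥(maximalRealSubfield L)))ˣ]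
    [BorelSpace (AdeleRing (𝓞 (↥(maximalRealSubfield L))) (↥(maximalRealSubfield L)))ˣ]
    {β : (quasiSplit (↥(maximalRealSubfield L)) L (IsCMField.complexConj L) 3).Adelic → ℝ≥0∞}
    (hβ : IsCoveringWeight ((arithmeticBorel (↥(maximalRealSubfield L)) L (IsCMField.complexConj L) 3).map (quasiSplit (↥(maximalRealSubfield L)) L (IsCMField.complexConj L) 3).arithmeticSubgroup.subtype) β)
    (μB : Measure (borelAdelic (↥(maximalRealSubfield L)) L (IsCMField.complexConj L) 3)) [μB.IsHaarMeasure]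
    (μK : Measure ((standardMaximalCompactGL 3 L).comap
      (adelicVal (↥(maximalRealSubfield L)) L (IsCMField.complexConj L) 3 ((StdForm.antidiagonal 3).over L)) : Subgroup (quasiSplit (↥(maximalRealSubfield L)) L (IsCMField.complexConj L) 3).Adelic))
    [μK.IsHaarMeasure]
    (μT : Measure (torusInBorel (↥(maximalRealSubfield L)) L (IsCMField.complexConj L) 3)) [μT.IsHaarMeasure]
    (μX : Measure (AdeleRing (𝓞 L) L)) [μX.IsAddHaarMeasure]
    (μY : Measure (traceZeroAdele (↥(maximalRealSubfield L)) L (IsCMField.complexConj L))) [μY.IsAddHaarMeasure]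
    {wT : torusInBorel (↥(maximalRealSubfield L)) L (IsCMField.complexConj L) 3 → ℝ≥0∞}
    (hwT : IsCoveringWeight ((((quasiSplit (↥(maximalRealSubfield L)) L (IsCMField.complexConj L) 3).arithmeticSubgroup).subgroupOf (borelAdelic (↥(maximalRealSubfield L)) L (IsCMField.complexConj L) 3)).subgroupOf
      (torusInBorel (↥(maximalRealSubfield L)) L (IsCMField.complexConj L) 3)) wT)
    {δ : L} (hcδ : (IsCMField.complexConj L) δ = -δ) (hδ : δ ≠ 0) (θ : 𝓞 (↥(maximalRealSubfield L))) (hθ : θ ≠ 0)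
    (hd : δ * δ = algebraMap (↥(maximalRealSubfield L)) L (θ : (↥(maximalRealSubfield L))))
    (μF : Measure (AdeleRing (𝓞 (↥(maximalRealSubfield L))) (↥(maximalRealSubfield L)))ˣ) [IsHaarMeasure μF]
    (νI : Measure (GaloisRepresentations.ideleGroup L)) [νI.IsHaarMeasure]
    {𝓕E : Set (GaloisRepresentations.ideleGroup L)} (h𝓕E : IsIdeleClassDomain L 𝓕E)
    (hS : ∀ (a b : Lˣ) (g₀ : (quasiSplit (↥(maximalRealSubfield L)) L (IsCMField.complexConj L) 3).Rational), (IsCMField.complexConj L) (a : L) * (a : L) = 1 → (IsCMField.complexConj L) (b : L) * (b : L) = 1 →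
      (a : L) ≠ (b : L) → ((g₀.val : GL (Fin 3) L) : Matrix (Fin 3) (Fin 3) L) = !![(a : L), 0, 0; 0, b, 0; 0, 0, a] →
      Integrable ((quasiSplit (↥(maximalRealSubfield L)) L (IsCMField.complexConj L) 3).quotFun (fun y : (quasiSplit (↥(maximalRealSubfield L)) L (IsCMField.complexConj L) 3).Adelic =>
        ∑' s : ↥(conjOrbit (quasiSplit (↥(maximalRealSubfield L)) L (IsCMField.complexConj L) 3).arithmeticSubgroup ((quasiSplit (↥(maximalRealSubfield L)) L (IsCMField.complexConj L) 3).toAdelic g₀)),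
          f (y⁻¹ * (s : (quasiSplit (↥(maximalRealSubfield L)) L (IsCMField.complexConj L) 3).Adelic) * y))) μ) :
    haveI := t2Space_quasiSplitAdelic (F := ↥(maximalRealSubfield L)) (E := L) (c := IsCMField.complexConj L) (N := 3)
    haveI := locallyCompactSpace_quasiSplitAdelic (F := ↥(maximalRealSubfield L)) (E := L) (c := IsCMField.complexConj L) (N := 3)
    haveI := secondCountableTopology_quasiSplitAdelic (F := ↥(maximalRealSubfield L)) (E := L) (c := IsCMField.complexConj L) (N := 3)
    haveI : IsClosed (((quasiSplit (↥(maximalRealSubfield L)) L (IsCMField.complexConj L) 3).quotientSubgroup : Set (quasiSplit (↥(maximalRealSubfield L)) L (IsCMField.complexConj L) 3).Adelic)) :=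
      isClosed_quotientSubgroup_quasiSplit
    haveI : ∀ γ : (quasiSplit (↥(maximalRealSubfield L)) L (IsCMField.complexConj L) 3).Adelic, IsClosed ((Subgroup.centralizer ({γ} : Set (quasiSplit (↥(maximalRealSubfield L)) L (IsCMField.complexConj L) 3).Adelic) :
        Subgroup (quasiSplit (↥(maximalRealSubfield L)) L (IsCMField.complexConj L) 3).Adelic) : Set (quasiSplit (↥(maximalRealSubfield L)) L (IsCMField.complexConj L) 3).Adelic) := isClosed_centralizer_quasiSplit
    haveI : ∀ γ : (quasiSplit (↥(maximalRealSubfield L)) L (IsCMField.complexConj L) 3).Adelic, (count : Measure ↥(((quasiSplit (↥(maximalRealSubfield L)) L (IsCMField.complexConj L) 3).quotientSubgroup ⊓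
        Subgroup.centralizer ({γ} : Set (quasiSplit (↥(maximalRealSubfield L)) L (IsCMField.complexConj L) 3).Adelic)).subgroupOf
          (Subgroup.centralizer ({γ} : Set (quasiSplit (↥(maximalRealSubfield L)) L (IsCMField.complexConj L) 3).Adelic)))).IsHaarMeasure :=
      isHaarMeasure_count_inf_centralizer_subgroupOf_quasiSplit
    haveI : (count : Measure (quasiSplit (↥(maximalRealSubfield L)) L (IsCMField.complexConj L) 3).quotientSubgroup).IsHaarMeasure :=
      isHaarMeasure_count_quotientSubgroup_quasiSplit
    haveI : ν.IsMulRightInvariant := isMulRightInvariant_quasiSplit_cm_three L ν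
    letI := AdelicGroupData.measurableSpaceQuotientForm (quasiSplit (↥(maximalRealSubfield L)) L (IsCMField.complexConj L) 3)
    haveI := AdelicGroupData.borelSpaceQuotientForm (quasiSplit (↥(maximalRealSubfield L)) L (IsCMField.complexConj L) 3)
    haveI := AdelicGroupData.smulInvariantMeasureQuotientForm (quasiSplit (↥(maximalRealSubfield L)) L (IsCMField.complexConj L) 3) μ
    haveI := AdelicGroupData.isFiniteMeasureOnCompactsQuotientForm (quasiSplit (↥(maximalRealSubfield L)) L (IsCMField.complexConj L) 3) μ
    (∀ (c : ConjClasses (quasiSplit (↥(maximalRealSubfield L)) L (IsCMField.complexConj L) 3).Rational)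
        (hc : ∀ β : ↥(arithmeticBorel (↥(maximalRealSubfield L)) L (IsCMField.complexConj L) 3),
          (((adelicVal (↥(maximalRealSubfield L)) L (IsCMField.complexConj L) 3 _ ((β : ↥(quasiSplit (↥(maximalRealSubfield L)) L (IsCMField.complexConj L) 3).arithmeticSubgroup) : (quasiSplit (↥(maximalRealSubfield L)) L (IsCMField.complexConj L) 3).Adelic) :
                GL (Fin 3) (AdeleRing (𝓞 L) L)) : Matrix (Fin 3) (Fin 3) (AdeleRing (𝓞 L) L)).charpoly,
              decide (∃ δ : ↥(quasiSplit (↥(maximalRealSubfield L)) L (IsCMField.complexConj L) 3).arithmeticSubgroup, δ * (β : ↥(quasiSplit (↥(maximalRealSubfield L)) L (IsCMField.complexConj L) 3).arithmeticSubgroup) * δ⁻¹ ∈ arithmeticBorel (↥(maximalRealSubfield L)) L (IsCMField.complexConj L) 3)) ≠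
          (((adelicVal (↥(maximalRealSubfield L)) L (IsCMField.complexConj L) 3 _ ((⟨(quasiSplit (↥(maximalRealSubfield L)) L (IsCMField.complexConj L) 3).toAdelic (Quotient.out c), Quotient.out c, rfl⟩ : ↥(quasiSplit (↥(maximalRealSubfield L)) L (IsCMField.complexConj L) 3).arithmeticSubgroup) : (quasiSplit (↥(maximalRealSubfield L)) L (IsCMField.complexConj L) 3).Adelic) :
                GL (Fin 3) (AdeleRing (𝓞 L) L)) : Matrix (Fin 3) (Fin 3) (AdeleRing (𝓞 L) L)).charpoly,
              decide (∃ δ : ↥(quasiSplit (↥(maximalRealSubfield L)) L (IsCMField.complexConj L) 3).arithmeticSubgroup, δ * ((⟨(quasiSplit (↥(maximalRealSubfield L)) L (IsCMField.complexConj L) 3).toAdelic (Quotient.out c), Quotient.out c, rfl⟩ : ↥(quasiSplit (↥(maximalRealSubfield L)) L (IsCMField.complexConj L) 3).arithmeticSubgroup)) * δ⁻¹ ∈ arithmeticBorel (↥(maximalRealSubfield L)) L (IsCMField.complexConj L) 3))),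
        haveI : (νR c).IsMulRightInvariant :=
          isMulRightInvariant_centralizer_of_forall_cl_ne (complexConj_mul_complexConj L)
            (isConjInvariant_borelRefine isConjInvariant_charpoly_adelicVal) hc (γ := (⟨(quasiSplit (↥(maximalRealSubfield L)) L (IsCMField.complexConj L) 3).toAdelic (Quotient.out c), Quotient.out c, rfl⟩ : ↥(quasiSplit (↥(maximalRealSubfield L)) L (IsCMField.complexConj L) 3).arithmeticSubgroup)) rfl (νR c);
        haveI : (νR c).IsInvInvariant :=
          isInvInvariant_centralizer_of_forall_cl_ne (complexConj_mul_complexConj L)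
            (isConjInvariant_borelRefine isConjInvariant_charpoly_adelicVal) hc (γ := (⟨(quasiSplit (↥(maximalRealSubfield L)) L (IsCMField.complexConj L) 3).toAdelic (Quotient.out c), Quotient.out c, rfl⟩ : ↥(quasiSplit (↥(maximalRealSubfield L)) L (IsCMField.complexConj L) 3).arithmeticSubgroup)) rfl (νR c);
        m c = quotientMeasure (Subgroup.centralizer ({(quasiSplit (↥(maximalRealSubfield L)) L (IsCMField.complexConj L) 3).toAdelic (Quotient.out c)} : Set (quasiSplit (↥(maximalRealSubfield L)) L (IsCMField.complexConj L) 3).Adelic)) (νR c)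
          (isClosed_centralizer_quasiSplit _) ν) →
    ∃ (zrep : (AdeleRing (𝓞 L) L)[X] × Bool → ratOne (↥(maximalRealSubfield L)) L (IsCMField.complexConj L) × (ℝ≥0 × ℝ × ℝ≥0∞))
      (srep : (AdeleRing (𝓞 L) L)[X] × Bool → (Lˣ × Lˣ) × (ℂ × ℂ))
      (hyrep : (AdeleRing (𝓞 L) L)[X] × Bool → (quasiSplit (↥(maximalRealSubfield L)) L (IsCMField.complexConj L) 3).Rational),
      ∀ T : ℝ≥0, arthurTrace μ ν₀ 𝓕 f =
        (∑ i ∈ (((finite_setOf_borelRefine_charpoly_of_isCompact (F := ↥(maximalRealSubfield L)) (E := L) (c := IsCMField.complexConj L) (N := 3)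
          hf.hasCompactSupport'.isCompact).toFinset).filter (fun i => ∀ β : ↥(arithmeticBorel (↥(maximalRealSubfield L)) L (IsCMField.complexConj L) 3),
            (((adelicVal (↥(maximalRealSubfield L)) L (IsCMField.complexConj L) 3 _ ((β : ↥(quasiSplit (↥(maximalRealSubfield L)) L (IsCMField.complexConj L) 3).arithmeticSubgroup) : (quasiSplit (↥(maximalRealSubfield L)) L (IsCMField.complexConj L) 3).Adelic) :
                GL (Fin 3) (AdeleRing (𝓞 L) L)) : Matrix (Fin 3) (Fin 3) (AdeleRing (𝓞 L) L)).charpoly,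
              decide (∃ δ : ↥(quasiSplit (↥(maximalRealSubfield L)) L (IsCMField.complexConj L) 3).arithmeticSubgroup, δ * (β : ↥(quasiSplit (↥(maximalRealSubfield L)) L (IsCMField.complexConj L) 3).arithmeticSubgroup) * δ⁻¹ ∈ arithmeticBorel (↥(maximalRealSubfield L)) L (IsCMField.complexConj L) 3)) ≠ i)).attach,
          ((unfoldingConstant (quasiSplit (↥(maximalRealSubfield L)) L (IsCMField.complexConj L) 3).quotientSubgroup
              (count : Measure (quasiSplit (↥(maximalRealSubfield L)) L (IsCMField.complexConj L) 3).quotientSubgroup) μ ν : ℝ) : ℂ) *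
            ∑' c : {c : ConjClasses (quasiSplit (↥(maximalRealSubfield L)) L (IsCMField.complexConj L) 3).Rational //
                (((adelicVal (↥(maximalRealSubfield L)) L (IsCMField.complexConj L) 3 _ ((⟨(quasiSplit (↥(maximalRealSubfield L)) L (IsCMField.complexConj L) 3).toAdelic (Quotient.out c), Quotient.out c, rfl⟩ : ↥(quasiSplit (↥(maximalRealSubfield L)) L (IsCMField.complexConj L) 3).arithmeticSubgroup) : (quasiSplit (↥(maximalRealSubfield L)) L (IsCMField.complexConj L) 3).Adelic) :
                GL (Fin 3) (AdeleRing (𝓞 L) L)) : Matrix (Fin 3) (Fin 3) (AdeleRing (𝓞 L) L)).charpoly,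
              decide (∃ δ : ↥(quasiSplit (↥(maximalRealSubfield L)) L (IsCMField.complexConj L) 3).arithmeticSubgroup, δ * ((⟨(quasiSplit (↥(maximalRealSubfield L)) L (IsCMField.complexConj L) 3).toAdelic (Quotient.out c), Quotient.out c, rfl⟩ : ↥(quasiSplit (↥(maximalRealSubfield L)) L (IsCMField.complexConj L) 3).arithmeticSubgroup)) * δ⁻¹ ∈ arithmeticBorel (↥(maximalRealSubfield L)) L (IsCMField.complexConj L) 3)) = i.1},
              (haveI : (νR c.1).IsMulRightInvariant :=
                  isMulRightInvariant_centralizer_of_forall_cl_ne (complexConj_mul_complexConj L)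
                    (isConjInvariant_borelRefine isConjInvariant_charpoly_adelicVal) (Finset.mem_filter.1 i.2).2 c.2 (νR c.1);
                haveI : (νR c.1).IsInvInvariant :=
                  isInvInvariant_centralizer_of_forall_cl_ne (complexConj_mul_complexConj L)
                    (isConjInvariant_borelRefine isConjInvariant_charpoly_adelicVal) (Finset.mem_filter.1 i.2).2 c.2 (νR c.1);
                ((quotientMeasure (((quasiSplit (↥(maximalRealSubfield L)) L (IsCMField.complexConj L) 3).quotientSubgroup ⊓
                    Subgroup.centralizer ({(quasiSplit (↥(maximalRealSubfield L)) L (IsCMField.complexConj L) 3).toAdelic (Quotient.out c.1)} : Set (quasiSplit (↥(maximalRealSubfield L)) L (IsCMField.complexConj L) 3).Adelic)).subgroupOf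
                    (Subgroup.centralizer ({(quasiSplit (↥(maximalRealSubfield L)) L (IsCMField.complexConj L) 3).toAdelic (Quotient.out c.1)} : Set (quasiSplit (↥(maximalRealSubfield L)) L (IsCMField.complexConj L) 3).Adelic)))
                    count (isClosed_inf_centralizer_subgroupOf_quasiSplit _) (νR c.1) Set.univ).toReal : ℂ) *
                  classOrbitalIntegralAlong (quasiSplit (↥(maximalRealSubfield L)) L (IsCMField.complexConj L) 3).toAdelic m f c.1)) +
        ((∑ i ∈ ((finite_setOf_borelRefine_charpoly_of_isCompact (F := ↥(maximalRealSubfield L)) (E := L) (c := IsCMField.complexConj L) (N := 3)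
          hf.hasCompactSupport'.isCompact).toFinset).filter (fun i : (AdeleRing (𝓞 L) L)[X] × Bool => i.2 = true ∧
            ∃ z : Lˣ, (IsCMField.complexConj L) (z : L) * (z : L) = 1 ∧
              i.1 = ((X - C (z : L)) ^ 3).map (algebraMap L (AdeleRing (𝓞 L) L))),

          ((μ.real Set.univ : ℝ) • f ((quasiSplit (↥(maximalRealSubfield L)) L (IsCMField.complexConj L) 3).toAdelic (ratCenter (↥(maximalRealSubfield L)) L (IsCMField.complexConj L) 3 ((StdForm.antidiagonal 3).over L) (zrep i).1)) +
            ((unfoldingConstant (quasiSplit (↥(maximalRealSubfield L)) L (IsCMField.complexConj L) 3).quotientSubgroup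
            (count : Measure (quasiSplit (↥(maximalRealSubfield L)) L (IsCMField.complexConj L) 3).quotientSubgroup) μ ν : ℝ) : ℂ) * (((((zrep i).2.1 : ℝ) : ℂ) * ((heisHaar (complexConj_mul_complexConj L) μX μY).real
              (heisHomeomorph (complexConj_mul_complexConj L) '' (adeleFundamentalDomain L ×ˢ traceZeroFundamentalDomain (↥(maximalRealSubfield L)) L (IsCMField.complexConj L))) : ℂ) *
            ∫ y in ↑(GaloisRepresentations.principalIdeles (↥(maximalRealSubfield L)) ⊔ normIdeles (↥(maximalRealSubfield L)) (θ : (↥(maximalRealSubfield L)))),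
              (((IdeleClassGroup.ideleNorm (↥(maximalRealSubfield L)) y ^ 2)⁻¹ : ℝ≥0) : ℝ) •
                ∫ k, f ((k : (quasiSplit (↥(maximalRealSubfield L)) L (IsCMField.complexConj L) 3).Adelic)⁻¹ * (((quasiSplit (↥(maximalRealSubfield L)) L (IsCMField.complexConj L) 3).toAdelic (ratCenter (↥(maximalRealSubfield L)) L (IsCMField.complexConj L) 3 ((StdForm.antidiagonal 3).over L) (zrep i).1)) *
                  ((heisChart (complexConj_mul_complexConj L) ((0 : AdeleRing (𝓞 L) L),
                      traceZeroLine (↥(maximalRealSubfield L)) L (IsCMField.complexConj L) hcδ hδ (((y⁻¹ : (AdeleRing (𝓞 (↥(maximalRealSubfield L))) (↥(maximalRealSubfield L)))ˣ)) : AdeleRing (𝓞 (↥(maximalRealSubfield L))) (↥(maximalRealSubfield L)))) :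
                    adelicUnipotent (↥(maximalRealSubfield L)) L (IsCMField.complexConj L) 3) : (quasiSplit (↥(maximalRealSubfield L)) L (IsCMField.complexConj L) 3).Adelic)) * (k : (quasiSplit (↥(maximalRealSubfield L)) L (IsCMField.complexConj L) 3).Adelic)) ∂μK
              ∂μF) +
          ((((zrep i).2.2.1 : ℝ) : ℂ) * ((μX.real (adeleFundamentalDomain L) : ℂ) * (((zrep i).2.2.2).toReal : ℂ)) *
            (((∫ x in {x | 1 ≤ (IdeleClassGroup.ideleNorm L x : ℝ)} ∩ 𝓕E,
                  ideleSum L (fun x => ∫ y' : traceZeroAdele (↥(maximalRealSubfield L)) L (IsCMField.complexConj L),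
        (∫ k, f ((k : (quasiSplit (↥(maximalRealSubfield L)) L (IsCMField.complexConj L) 3).Adelic)⁻¹ * (((quasiSplit (↥(maximalRealSubfield L)) L (IsCMField.complexConj L) 3).toAdelic (ratCenter (↥(maximalRealSubfield L)) L (IsCMField.complexConj L) 3 ((StdForm.antidiagonal 3).over L) (zrep i).1)) *
          (((heisChart (complexConj_mul_complexConj L) (x, y')) : adelicUnipotent (↥(maximalRealSubfield L)) L (IsCMField.complexConj L) 3) :
              (quasiSplit (↥(maximalRealSubfield L)) L (IsCMField.complexConj L) 3).Adelic)) * (k : (quasiSplit (↥(maximalRealSubfield L)) L (IsCMField.complexConj L) 3).Adelic)) ∂μK) ∂μY) x * ((IdeleClassGroup.ideleNorm L x : ℝ) : ℂ) ∂νI) +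
                ((μX (adeleFundamentalDomain L)).toReal⁻¹ : ℂ) *
                  (∫ x in {x | 1 ≤ (IdeleClassGroup.ideleNorm L x : ℝ)} ∩ 𝓕E,
                    ideleSum L (adeleFourier L μX (fun x => ∫ y' : traceZeroAdele (↥(maximalRealSubfield L)) L (IsCMField.complexConj L),
        (∫ k, f ((k : (quasiSplit (↥(maximalRealSubfield L)) L (IsCMField.complexConj L) 3).Adelic)⁻¹ * (((quasiSplit (↥(maximalRealSubfield L)) L (IsCMField.complexConj L) 3).toAdelic (ratCenter (↥(maximalRealSubfield L)) L (IsCMField.complexConj L) 3 ((StdForm.antidiagonal 3).over L) (zrep i).1)) *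
          (((heisChart (complexConj_mul_complexConj L) (x, y')) : adelicUnipotent (↥(maximalRealSubfield L)) L (IsCMField.complexConj L) 3) :
              (quasiSplit (↥(maximalRealSubfield L)) L (IsCMField.complexConj L) 3).Adelic)) * (k : (quasiSplit (↥(maximalRealSubfield L)) L (IsCMField.complexConj L) 3).Adelic)) ∂μK) ∂μY)) x ∂νI) -
                ((idelicCovolume L νI).toReal : ℂ) * (fun x => ∫ y' : traceZeroAdele (↥(maximalRealSubfield L)) L (IsCMField.complexConj L),
        (∫ k, f ((k : (quasiSplit (↥(maximalRealSubfield L)) L (IsCMField.complexConj L) 3).Adelic)⁻¹ * (((quasiSplit (↥(maximalRealSubfield L)) L (IsCMField.complexConj L) 3).toAdelic (ratCenter (↥(maximalRealSubfield L)) L (IsCMField.complexConj L) 3 ((StdForm.antidiagonal 3).over L) (zrep i).1)) *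
          (((heisChart (complexConj_mul_complexConj L) (x, y')) : adelicUnipotent (↥(maximalRealSubfield L)) L (IsCMField.complexConj L) 3) :
              (quasiSplit (↥(maximalRealSubfield L)) L (IsCMField.complexConj L) 3).Adelic)) * (k : (quasiSplit (↥(maximalRealSubfield L)) L (IsCMField.complexConj L) 3).Adelic)) ∂μK) ∂μY) 0) -
              (((idelicCovolume L νI).toReal : ℂ) * (((μX (adeleFundamentalDomain L)).toReal⁻¹ : ℂ) *
                  adeleFourier L μX (fun x => ∫ y' : traceZeroAdele (↥(maximalRealSubfield L)) L (IsCMField.complexConj L),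
        (∫ k, f ((k : (quasiSplit (↥(maximalRealSubfield L)) L (IsCMField.complexConj L) 3).Adelic)⁻¹ * (((quasiSplit (↥(maximalRealSubfield L)) L (IsCMField.complexConj L) 3).toAdelic (ratCenter (↥(maximalRealSubfield L)) L (IsCMField.complexConj L) 3 ((StdForm.antidiagonal 3).over L) (zrep i).1)) *
          (((heisChart (complexConj_mul_complexConj L) (x, y')) : adelicUnipotent (↥(maximalRealSubfield L)) L (IsCMField.complexConj L) 3) :
              (quasiSplit (↥(maximalRealSubfield L)) L (IsCMField.complexConj L) 3).Adelic)) * (k : (quasiSplit (↥(maximalRealSubfield L)) L (IsCMField.complexConj L) 3).Adelic)) ∂μK) ∂μY) 0)) *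
                ((Real.log (borelHeight (1 : (quasiSplit (↥(maximalRealSubfield L)) L (IsCMField.complexConj L) 3).Adelic) : ℝ) : ℝ) : ℂ)))))) +
          (∑ i ∈ ((finite_setOf_borelRefine_charpoly_of_isCompact (F := ↥(maximalRealSubfield L)) (E := L) (c := IsCMField.complexConj L) (N := 3)
          hf.hasCompactSupport'.isCompact).toFinset).filter (fun i : (AdeleRing (𝓞 L) L)[X] × Bool => i.2 = true ∧
            ∃ a b : Lˣ, (IsCMField.complexConj L) (a : L) * (a : L) = 1 ∧ (IsCMField.complexConj L) (b : L) * (b : L) = 1 ∧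
              (a : L) ≠ (b : L) ∧ i.1 = ((X - C (a : L)) ^ 2 * (X - C (b : L))).map (algebraMap L (AdeleRing (𝓞 L) L))),
            (srep i).2.2) +
          (∑ i ∈ ((finite_setOf_borelRefine_charpoly_of_isCompact (F := ↥(maximalRealSubfield L)) (E := L) (c := IsCMField.complexConj L) (N := 3)
          hf.hasCompactSupport'.isCompact).toFinset).filter (fun i : (AdeleRing (𝓞 L) L)[X] × Bool => i.2 = true ∧
            ∃ a b : Lˣ, (IsCMField.complexConj L) (a : L) * (a : L) ≠ 1 ∧ (IsCMField.complexConj L) (b : L) * (b : L) = 1 ∧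
              i.1 = ((X - C (a : L)) * (X - C (b : L)) * (X - C ((IsCMField.complexConj L) (a : L))⁻¹)).map (algebraMap L (AdeleRing (𝓞 L) L))),
            -(((unfoldingConstant (quasiSplit (↥(maximalRealSubfield L)) L (IsCMField.complexConj L) 3).quotientSubgroup
              (count : Measure (quasiSplit (↥(maximalRealSubfield L)) L (IsCMField.complexConj L) 3).quotientSubgroup) μ ν : ℝ) : ℂ) *
            (Cw.toReal : ℂ) *
            ∫ x : (quasiSplit (↥(maximalRealSubfield L)) L (IsCMField.complexConj L) 3).Adelic ⧸
                torusAdelic (↥(maximalRealSubfield L)) L (IsCMField.complexConj L) 3,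
              f ((x.out : (quasiSplit (↥(maximalRealSubfield L)) L (IsCMField.complexConj L) 3).Adelic) *
                  (quasiSplit (↥(maximalRealSubfield L)) L (IsCMField.complexConj L) 3).toAdelic (hyrep i) *
                  (x.out : (quasiSplit (↥(maximalRealSubfield L)) L (IsCMField.complexConj L) 3).Adelic)⁻¹) *
                ((Real.log (borelHeight (x.out : (quasiSplit (↥(maximalRealSubfield L)) L (IsCMField.complexConj L) 3).Adelic)⁻¹) +
                  Real.log (borelHeight ((quasiSplit (↥(maximalRealSubfield L)) L (IsCMField.complexConj L) 3).toAdelic w *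
                    (x.out : (quasiSplit (↥(maximalRealSubfield L)) L (IsCMField.complexConj L) 3).Adelic)⁻¹)) : ℝ) : ℂ)
              ∂(quotientMeasure (torusAdelic (↥(maximalRealSubfield L)) L (IsCMField.complexConj L) 3) ρ isClosed_torusAdelic ν)))) := by
  -- instance preamble of ★ `truncatedTraceClass_central_eq_linear_cm` (for the spelled `Bc` below)
  haveI := t2Space_adeleRing_of_numberField L
  haveI := locallyCompactSpace_adeleRing' L
  haveI := secondCountableTopology_adeleRing L
  haveI : T2Space (quasiSplit (↥(maximalRealSubfield L)) L (IsCMField.complexConj L) 3).Adelic :=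
    inferInstanceAs (T2Space (adelic (↥(maximalRealSubfield L)) L (IsCMField.complexConj L) 3 ((StdForm.antidiagonal 3).over L)))
  haveI : LocallyCompactSpace (quasiSplit (↥(maximalRealSubfield L)) L (IsCMField.complexConj L) 3).Adelic :=
    inferInstanceAs (LocallyCompactSpace (adelic (↥(maximalRealSubfield L)) L (IsCMField.complexConj L) 3 ((StdForm.antidiagonal 3).over L)))
  haveI : SecondCountableTopology (quasiSplit (↥(maximalRealSubfield L)) L (IsCMField.complexConj L) 3).Adelic :=
    inferInstanceAs (SecondCountableTopology (adelic (↥(maximalRealSubfield L)) L (IsCMField.complexConj L) 3 ((StdForm.antidiagonal 3).over L)))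
  haveI : DiscreteTopology (quasiSplit (↥(maximalRealSubfield L)) L (IsCMField.complexConj L) 3).quotientSubgroup := by
    rw [quotientSubgroup_quasiSplit]; exact isDiscreteRational_quasiSplit
  letI := AdelicGroupData.measurableSpaceQuotientForm (quasiSplit (↥(maximalRealSubfield L)) L (IsCMField.complexConj L) 3)
  haveI := AdelicGroupData.borelSpaceQuotientForm (quasiSplit (↥(maximalRealSubfield L)) L (IsCMField.complexConj L) 3)
  haveI := AdelicGroupData.smulInvariantMeasureQuotientForm (quasiSplit (↥(maximalRealSubfield L)) L (IsCMField.complexConj L) 3) μ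
  haveI := AdelicGroupData.isFiniteMeasureOnCompactsQuotientForm (quasiSplit (↥(maximalRealSubfield L)) L (IsCMField.complexConj L) 3) μ
  intro hm
  have h := arthurTrace_eq_sum_classOrbitalIntegralAlong_add_central_add_singular_add_hyperbolic_of_closers_cm L ν μ ν₀ 𝓕 h𝓕 νR m f hf ρ hw hC hwin
    (κc := ratOne (↥(maximalRealSubfield L)) L (IsCMField.complexConj L) × (ℝ≥0 × ℝ × ℝ≥0∞)) (κs := (Lˣ × Lˣ) × (ℂ × ℂ))
    (fun p : ratOne (↥(maximalRealSubfield L)) L (IsCMField.complexConj L) × (ℝ≥0 × ℝ × ℝ≥0∞) =>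
          ((μ.real Set.univ : ℝ) • f ((quasiSplit (↥(maximalRealSubfield L)) L (IsCMField.complexConj L) 3).toAdelic (ratCenter (↥(maximalRealSubfield L)) L (IsCMField.complexConj L) 3 ((StdForm.antidiagonal 3).over L) p.1)) +
            ((unfoldingConstant (quasiSplit (↥(maximalRealSubfield L)) L (IsCMField.complexConj L) 3).quotientSubgroup
            (count : Measure (quasiSplit (↥(maximalRealSubfield L)) L (IsCMField.complexConj L) 3).quotientSubgroup) μ ν : ℝ) : ℂ) * ((((p.2.1 : ℝ) : ℂ) * ((heisHaar (complexConj_mul_complexConj L) μX μY).real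
              (heisHomeomorph (complexConj_mul_complexConj L) '' (adeleFundamentalDomain L ×ˢ traceZeroFundamentalDomain (↥(maximalRealSubfield L)) L (IsCMField.complexConj L))) : ℂ) *
            ∫ y in ↑(GaloisRepresentations.principalIdeles (↥(maximalRealSubfield L)) ⊔ normIdeles (↥(maximalRealSubfield L)) (θ : (↥(maximalRealSubfield L)))),
              (((IdeleClassGroup.ideleNorm (↥(maximalRealSubfield L)) y ^ 2)⁻¹ : ℝ≥0) : ℝ) •
                ∫ k, f ((k : (quasiSplit (↥(maximalRealSubfield L)) L (IsCMField.complexConj L) 3).Adelic)⁻¹ * (((quasiSplit (↥(maximalRealSubfield L)) L (IsCMField.complexConj L) 3).toAdelic (ratCenter (↥(maximalRealSubfield L)) L (IsCMField.complexConj L) 3 ((StdForm.antidiagonal 3).over L) p.1)) *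
                  ((heisChart (complexConj_mul_complexConj L) ((0 : AdeleRing (𝓞 L) L),
                      traceZeroLine (↥(maximalRealSubfield L)) L (IsCMField.complexConj L) hcδ hδ (((y⁻¹ : (AdeleRing (𝓞 (↥(maximalRealSubfield L))) (↥(maximalRealSubfield L)))ˣ)) : AdeleRing (𝓞 (↥(maximalRealSubfield L))) (↥(maximalRealSubfield L)))) :
                    adelicUnipotent (↥(maximalRealSubfield L)) L (IsCMField.complexConj L) 3) : (quasiSplit (↥(maximalRealSubfield L)) L (IsCMField.complexConj L) 3).Adelic)) * (k : (quasiSplit (↥(maximalRealSubfield L)) L (IsCMField.complexConj L) 3).Adelic)) ∂μK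
              ∂μF) +
          (((p.2.2.1 : ℝ) : ℂ) * ((μX.real (adeleFundamentalDomain L) : ℂ) * ((p.2.2.2).toReal : ℂ)) *
            (((∫ x in {x | 1 ≤ (IdeleClassGroup.ideleNorm L x : ℝ)} ∩ 𝓕E,
                  ideleSum L (fun x => ∫ y' : traceZeroAdele (↥(maximalRealSubfield L)) L (IsCMField.complexConj L),
        (∫ k, f ((k : (quasiSplit (↥(maximalRealSubfield L)) L (IsCMField.complexConj L) 3).Adelic)⁻¹ * (((quasiSplit (↥(maximalRealSubfield L)) L (IsCMField.complexConj L) 3).toAdelic (ratCenter (↥(maximalRealSubfield L)) L (IsCMField.complexConj L) 3 ((StdForm.antidiagonal 3).over L) p.1)) *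
          (((heisChart (complexConj_mul_complexConj L) (x, y')) : adelicUnipotent (↥(maximalRealSubfield L)) L (IsCMField.complexConj L) 3) :
              (quasiSplit (↥(maximalRealSubfield L)) L (IsCMField.complexConj L) 3).Adelic)) * (k : (quasiSplit (↥(maximalRealSubfield L)) L (IsCMField.complexConj L) 3).Adelic)) ∂μK) ∂μY) x * ((IdeleClassGroup.ideleNorm L x : ℝ) : ℂ) ∂νI) +
                ((μX (adeleFundamentalDomain L)).toReal⁻¹ : ℂ) *
                  (∫ x in {x | 1 ≤ (IdeleClassGroup.ideleNorm L x : ℝ)} ∩ 𝓕E,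
                    ideleSum L (adeleFourier L μX (fun x => ∫ y' : traceZeroAdele (↥(maximalRealSubfield L)) L (IsCMField.complexConj L),
        (∫ k, f ((k : (quasiSplit (↥(maximalRealSubfield L)) L (IsCMField.complexConj L) 3).Adelic)⁻¹ * (((quasiSplit (↥(maximalRealSubfield L)) L (IsCMField.complexConj L) 3).toAdelic (ratCenter (↥(maximalRealSubfield L)) L (IsCMField.complexConj L) 3 ((StdForm.antidiagonal 3).over L) p.1)) *
          (((heisChart (complexConj_mul_complexConj L) (x, y')) : adelicUnipotent (↥(maximalRealSubfield L)) L (IsCMField.complexConj L) 3) :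
              (quasiSplit (↥(maximalRealSubfield L)) L (IsCMField.complexConj L) 3).Adelic)) * (k : (quasiSplit (↥(maximalRealSubfield L)) L (IsCMField.complexConj L) 3).Adelic)) ∂μK) ∂μY)) x ∂νI) -
                ((idelicCovolume L νI).toReal : ℂ) * (fun x => ∫ y' : traceZeroAdele (↥(maximalRealSubfield L)) L (IsCMField.complexConj L),
        (∫ k, f ((k : (quasiSplit (↥(maximalRealSubfield L)) L (IsCMField.complexConj L) 3).Adelic)⁻¹ * (((quasiSplit (↥(maximalRealSubfield L)) L (IsCMField.complexConj L) 3).toAdelic (ratCenter (↥(maximalRealSubfield L)) L (IsCMField.complexConj L) 3 ((StdForm.antidiagonal 3).over L) p.1)) *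
          (((heisChart (complexConj_mul_complexConj L) (x, y')) : adelicUnipotent (↥(maximalRealSubfield L)) L (IsCMField.complexConj L) 3) :
              (quasiSplit (↥(maximalRealSubfield L)) L (IsCMField.complexConj L) 3).Adelic)) * (k : (quasiSplit (↥(maximalRealSubfield L)) L (IsCMField.complexConj L) 3).Adelic)) ∂μK) ∂μY) 0) -
              (((idelicCovolume L νI).toReal : ℂ) * (((μX (adeleFundamentalDomain L)).toReal⁻¹ : ℂ) *
                  adeleFourier L μX (fun x => ∫ y' : traceZeroAdele (↥(maximalRealSubfield L)) L (IsCMField.complexConj L),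
        (∫ k, f ((k : (quasiSplit (↥(maximalRealSubfield L)) L (IsCMField.complexConj L) 3).Adelic)⁻¹ * (((quasiSplit (↥(maximalRealSubfield L)) L (IsCMField.complexConj L) 3).toAdelic (ratCenter (↥(maximalRealSubfield L)) L (IsCMField.complexConj L) 3 ((StdForm.antidiagonal 3).over L) p.1)) *
          (((heisChart (complexConj_mul_complexConj L) (x, y')) : adelicUnipotent (↥(maximalRealSubfield L)) L (IsCMField.complexConj L) 3) :
              (quasiSplit (↥(maximalRealSubfield L)) L (IsCMField.complexConj L) 3).Adelic)) * (k : (quasiSplit (↥(maximalRealSubfield L)) L (IsCMField.complexConj L) 3).Adelic)) ∂μK) ∂μY) 0)) *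
                ((Real.log (borelHeight (1 : (quasiSplit (↥(maximalRealSubfield L)) L (IsCMField.complexConj L) 3).Adelic) : ℝ) : ℝ) : ℂ))))))
    (fun p : (Lˣ × Lˣ) × (ℂ × ℂ) => p.2.2)
    (exists_keyrep_sum_filter_central_classPolynomial_eval_zero_cm L ν₀ h𝓕 hf μ ν hβ μB μK μT μX μY hwT hcδ hδ θ hθ hd
      μF νI h𝓕E)
    (exists_keyrep_sum_filter_singular_classPolynomial_eval_zero_cm L hcδ hδ θ hθ hd ν₀ h𝓕 μ hf hS) hm
  cases h with
  | intro zrep h1 =>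
    cases h1 with
    | intro srep h2 =>
      cases h2 with
      | intro hyrep hJ => exact ⟨zrep, srep, hyrep, hJ⟩

end UnitaryGroup

end Literature.NumberTheory.Automorphic

end
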